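import Literature.NumberTheory.EllipticCurves.HalfIntegralWeightFormsProofs
import HarnessLib

/-!
# Crux `PrintCFram.BottomClassIndexLawFiveLe` (stmt-BirchSwinnertonDyer-20372), line `eisenstein-resource-bdp-line` (registry v29 `stub_flipRungs.2`,
# the `8 ∣ m` half = LEAD's residual `stub_rungTwoEight` / w6 g10's (JMLTwoEight⁶)):
# THE 2-ADIC FLIPPED-CUSP RUNG FOR `e = 3`, piece P6b — THE WEIGHTS AT MODULUS `16` ARE UNITS ON THE CLASSES `≡ 2 (mod 4)`
# (cell `bsd-print-cfram`, width seat `bsd-line-cfram-p1-w8` g10; THEOREMS ONLY, `--supports` 20372 `--as helper`; BSD is not proved by any of this)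

HONEST FRAMING. A finite computation with roots of unity and Shimura's `ε_d`; nothing here is a statement about BSD, elliptic curves or Bernoulli
numbers; no registered stub is closed. This is the `R = 16` twin of w7 g8's T6a/P1b (`…FlipRungTwoGaussSums`, `…FlipRungTwoFlipWeights`):
the coefficient of `e(nw)` in the class-`c` cut (modulus `16`) of `g = G|U_4` read at the flipped cusp `W₁₆ = γ₀·diag(256,1)` is
`√(16(M′w+1))^K · W_c(n) · b(n)` (P6c `…FlipRungTwoEightFlipIdentity.hasSum_oddPartSixteen_flippedCusp_of_det`) with

    W_c(n) = Σ_{j odd < 16} (e(−cj/16)/16) · ψ(d_j)(ε_{d_j}⁻¹ J(16M′ | d_j))^K · e(y_j n/16),   d_j = 16 − M′y_j,  M′²·j·y_j ≡ −1 (mod 16).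

For the square levels `M′ = Q²` (`Q` odd — the level `4Q₀²` of the AWAY₂ cut, w7 g9 M1b) and the trivial character: `J(16M′|d_j) = J((4Q)²|d_j) = 1`,
`ψ(d_j) = 1`, `ε_{d_j} = ε_j` (`d_j ≡ j (mod 4)`), and `y_j ≡ −j (mod 8)`; so on the classes `c ≡ n ≡ 2 (mod 4)` — the classes `2m₁r` of the
`e = 3` indices — the phases collapse to `(−i)^{jt}`, `t = c/4 + n/4 + 1`, and

    W_c(n) = (v + s·v³)/4,  v = (−i)^t,  s = (−i)^K;   W_c(n) · 2(v³ − s·v) = 1   (`K` odd: `s² = −1`, `v⁴ = 1`),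

i.e. `|W_c(n)|² = 1/8` and `W_c(n)⁻¹ = 2(v³ − sv) ∈ ℤ[i]` is an algebraic integer: the weight is a UNIT at every odd prime, for EVERY `n ≡ 2 (mod 4)` —
NO dead class (numerically: seat folder `work/numerics/weights16.py`, exact, all `M′ ≤ 121` odd, `K ≤ 13`). This is the `|8w| = 2√2` dichotomy (ii) of
crux notes w7g8-T6 §1d reached WITHOUT `U_8`.

* §1 integer bookkeeping: `y_j + j ≡ 0 (mod 8)`, `d_j ≡ j (mod 4)`, `d_j` odd and prime to `4Q`, `J(16Q² | d_j) = 1`, `𝟙(d_j) = 1`.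
* §2 roots of unity: `e(A/16)` depends on `A mod 16`; the phase exponent `y_j n − cj ≡ −4jt (mod 16)`; `e(−4m/16) = (−i)^m`.
* §3 `flipWeightSixteen_term` (each term is `ε_j^{−K}(−i)^{jt}/16`), **`flipWeightSixteen_sum_eq`** (`W = (v + s v³)/4`),
  **`flipWeightSixteen_mul_eq_one`**, **`exists_isIntegral_mul_flipWeightSixteen_eq_one`** (abstract multiplier hypotheses) and
  **`exists_isIntegral_mul_flipWeightSixteen_eq_one_of_sq`** (`M′ = Q²`, trivial character: the hypotheses discharged).

No definitions, no named facts, no `sorry`. beyond-print theorem: NO. References: [Shimura1973HalfIntegral] §1 (`ε_d`, `j(γ,z)`); [IrelandRosen1990]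
Prop. 5.2.2; crux notes w7g8-T6 §1d, §3b, §5b (O3); w8 g10 STATUS 11:14:53Z (the `R = 16` road).
-/

set_option autoImplicit false
-- summit-side namespace `Summit.BirchSwinnertonDyer.BirchSwinnertonDyer.…` (single-conjunct summit, D-0017 layout)
set_option linter.dupNamespace false

noncomputable section

open Complex
open scoped NumberTheorySymbols Real
open Literature.NumberTheory.EllipticCurves.ModularForms (thetaEps thetaEps_eq_of_emod_eq)

namespace Summit.BirchSwinnertonDyer.BirchSwinnertonDyer.Theorems.PrintCFram.FlipRung

/-! ## §1 Integer bookkeeping for `d_j = 16 − M′y_j`, `M′²·j·y_j ≡ −1 (mod 16)` -/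

/-- From `M′²jy ≡ −1 (mod 16)` with `M′`, `j` odd: `y + j ≡ 0 (mod 8)` (`M′² ≡ j² ≡ 1 (mod 8)`). [folklore] -/
theorem add_modEq_zero_eight_of_solution {M j y : ℤ} (hM : Odd M) (hj : Odd j) (h : M ^ 2 * j * y ≡ -1 [ZMOD 16]) :
    y + j ≡ 0 [ZMOD 8] := by
  have h8 : M ^ 2 * j * y ≡ -1 [ZMOD 8] := Int.ModEq.of_mul_left 2 (by simpa using h)
  have key : ∀ a b u : ZMod 8, a * a * b * u = -1 → a * a = 1 → b * b = 1 → u + b = 0 := by decide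
  have hM8 : (M : ZMod 8) * (M : ZMod 8) = 1 := by
    obtain ⟨r, rfl⟩ := hM
    have : ((2 * r + 1 : ℤ) : ZMod 8) = 2 * (r : ZMod 8) + 1 := by push_cast; ring
    rw [this]
    have h2 : ∀ s : ZMod 8, (2 * s + 1) * (2 * s + 1) = 1 := by decide
    exact h2 _
  have hj8 : (j : ZMod 8) * (j : ZMod 8) = 1 := by
    obtain ⟨r, rfl⟩ := hj
    have : ((2 * r + 1 : ℤ) : ZMod 8) = 2 * (r : ZMod 8) + 1 := by push_cast; ring
    rw [this]
    have h2 : ∀ s : ZMod 8, (2 * s + 1) * (2 * s + 1) = 1 := by decide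
    exact h2 _
  have hc : ((M ^ 2 * j * y : ℤ) : ZMod 8) = ((-1 : ℤ) : ZMod 8) := (ZMod.intCast_eq_intCast_iff _ _ 8).mpr h8
  push_cast at hc
  have := key (M : ZMod 8) (j : ZMod 8) (y : ZMod 8) (by rw [← hc]; ring) hM8 hj8
  have h0 : ((y + j : ℤ) : ZMod 8) = ((0 : ℤ) : ZMod 8) := by push_cast; exact this
  exact (ZMod.intCast_eq_intCast_iff _ _ 8).mp h0

/-- From `M′²jy ≡ −1 (mod 16)` with `M′ ≡ 1 (mod 4)` and `j` odd: `d_j = 16 − M′y ≡ j (mod 4)`. [folklore] -/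
theorem d_emod_four_eq_of_solution {M j y : ℤ} (hM4 : M % 4 = 1) (hj : Odd j) (h : M ^ 2 * j * y ≡ -1 [ZMOD 16]) :
    (16 - M * y) % 4 = j % 4 := by
  have h4 : M ^ 2 * j * y ≡ -1 [ZMOD 4] := Int.ModEq.of_mul_left 4 (by simpa using h)
  have hM' : (M : ZMod 4) = 1 := by
    have : ((M : ℤ) : ZMod 4) = ((1 : ℤ) : ZMod 4) := (ZMod.intCast_eq_intCast_iff' _ _ 4).mpr (by simpa using hM4)
    simpa using this
  have hj4 : (j : ZMod 4) * (j : ZMod 4) = 1 := by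
    obtain ⟨r, rfl⟩ := hj
    have : ((2 * r + 1 : ℤ) : ZMod 4) = 2 * (r : ZMod 4) + 1 := by push_cast; ring
    rw [this]
    have h2 : ∀ s : ZMod 4, (2 * s + 1) * (2 * s + 1) = 1 := by decide
    exact h2 _
  have key : ∀ b u : ZMod 4, b * u = -1 → b * b = 1 → 16 - u = b := by decide
  have hc : ((M ^ 2 * j * y : ℤ) : ZMod 4) = ((-1 : ℤ) : ZMod 4) := (ZMod.intCast_eq_intCast_iff _ _ 4).mpr h4
  push_cast at hc
  rw [hM'] at hc
  have := key (j : ZMod 4) (y : ZMod 4) (by rw [← hc]; ring) hj4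
  have h0 : ((16 - M * y : ℤ) : ZMod 4) = ((j : ℤ) : ZMod 4) := by push_cast; rw [hM']; simpa using this
  exact (ZMod.intCast_eq_intCast_iff' _ _ 4).mp h0

/-- From `M′²jy ≡ −1 (mod 16)`: `y` is odd. [folklore] -/
theorem odd_y_of_solution {M j y : ℤ} (h : M ^ 2 * j * y ≡ -1 [ZMOD 16]) : Odd y := by
  obtain ⟨k, hk⟩ := (Int.modEq_iff_dvd.mp h.symm)
  have hodd : Odd (M ^ 2 * j * y) := ⟨8 * k - 1, by linear_combination hk⟩
  exact (Int.odd_mul.mp hodd).2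

/-- `d_j = 16 − M′y` is odd (`M′`, `y` odd). [folklore] -/
theorem odd_d_of_solution {M j y : ℤ} (hM : Odd M) (h : M ^ 2 * j * y ≡ -1 [ZMOD 16]) : Odd (16 - M * y) := by
  obtain ⟨r, hr⟩ := hM.mul (odd_y_of_solution h)
  exact ⟨7 - r, by linear_combination -hr⟩

/-- `d_j = 16 − Q²y` is prime to `Q` (`Q` odd: `Q` is prime to `16 = d_j + Q·(Qy)`). [folklore] -/
theorem isCoprime_Q_d {Q y : ℤ} (hQ : Odd Q) : IsCoprime Q (16 - Q ^ 2 * y) := by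
  have h2 : IsCoprime Q 2 := by
    obtain ⟨r, hr⟩ := hQ
    exact ⟨1, -r, by linear_combination hr⟩
  obtain ⟨s, t, hst⟩ := (IsCoprime.pow_right (n := 4) h2)
  exact ⟨s + t * Q * y, t, by linear_combination hst⟩

/-- `d_j` odd is prime to `4`. [folklore] -/
theorem isCoprime_four_of_odd {d : ℤ} (hd : Odd d) : IsCoprime 4 d := by
  have h2 : IsCoprime 2 d := by
    obtain ⟨r, hr⟩ := hd
    exact ⟨-r, 1, by linear_combination hr⟩
  have := h2.pow_left (m := 2)
  norm_num at this
  exact this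

/-- **`J(16Q² | d) = 1`** for `d` odd and prime to `Q`: `16Q² = (4Q)²` (no reciprocity needed at a square level). [cite: IrelandRosen1990, Prop. 5.2.2] -/
theorem jacobiSym_sixteen_mul_sq_eq_one {Q d : ℤ} (hQd : IsCoprime Q d) (hd : Odd d) : J(16 * Q ^ 2 | d.natAbs) = 1 := by
  rw [show (16 : ℤ) * Q ^ 2 = (4 * Q) ^ 2 by ring]
  apply jacobiSym.sq_one'
  have h : IsCoprime (4 * Q) d := (isCoprime_four_of_odd hd).mul_left hQd
  have hg : Int.gcd (4 * Q) (d.natAbs : ℤ) = Int.gcd (4 * Q) d := by simp [Int.gcd, Int.natAbs_abs]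
  rw [hg]
  exact Int.isCoprime_iff_gcd_eq_one.mp h

/-- **The trivial character at `d_j`**: `𝟙_{4Q²}(d) = 1` for `d` odd and prime to `Q`. [folklore] -/
theorem one_apply_d_eq_one {Q : ℕ} {d : ℤ} (hQd : IsCoprime (Q : ℤ) d) (hd : Odd d) :
    (1 : DirichletCharacter ℂ (4 * Q ^ 2)) ((d : ZMod (4 * Q ^ 2))) = 1 := by
  refine MulChar.one_apply ?_
  rw [ZMod.coe_int_isUnit_iff_isCoprime]
  push_cast
  exact (isCoprime_four_of_odd hd).mul_left (hQd.pow_left (m := 2))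

/-! ## §2 Roots of unity: `e(A/16)` depends on `A mod 16`; the phase exponent; `e(−4m/16) = (−i)^m` -/

/-- `e(A/16) = e(B/16)` for `A ≡ B (mod 16)`. [folklore] -/
theorem cexp_div_sixteen_eq_of_modEq {A B : ℤ} (h : A ≡ B [ZMOD 16]) :
    cexp (2 * π * I * (A : ℂ) / 16) = cexp (2 * π * I * (B : ℂ) / 16) := by
  obtain ⟨k, hk⟩ := Int.modEq_iff_dvd.mp h.symm
  have hA : (A : ℂ) = (B : ℂ) + 16 * (k : ℂ) := by
    have : A = B + 16 * k := by linear_combination hk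
    exact_mod_cast this
  rw [hA, show 2 * π * I * ((B : ℂ) + 16 * (k : ℂ)) / 16 = 2 * π * I * (B : ℂ) / 16 + k * (2 * π * I) by ring, Complex.exp_add,
    Complex.exp_int_mul_two_pi_mul_I, mul_one]

/-- **The phase exponent on the classes `c ≡ n ≡ 2 (mod 4)`**: for `y + j ≡ 0 (mod 8)`,
`y·n − c·j ≡ −4·j·(c/4 + n/4 + 1) (mod 16)`. [folklore] -/
theorem phaseExponent_modEq {c n : ℕ} (hc : c % 4 = 2) (hn : n % 4 = 2) {j y : ℤ} (hyj : y + j ≡ 0 [ZMOD 8]) :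
    y * n - c * j ≡ -(4 * (j * ((c / 4 + n / 4 + 1 : ℕ) : ℤ))) [ZMOD 16] := by
  obtain ⟨s, hs⟩ := Int.modEq_iff_dvd.mp hyj.symm
  have hc' : (c : ℤ) = 4 * ((c / 4 : ℕ) : ℤ) + 2 := by omega
  have hn' : (n : ℤ) = 4 * ((n / 4 : ℕ) : ℤ) + 2 := by omega
  refine Int.modEq_iff_dvd.mpr ⟨-((2 * ((n / 4 : ℕ) : ℤ) + 1) * s), ?_⟩
  simp only [Nat.cast_add, Nat.cast_one]
  linear_combination (-(4 * ((n / 4 : ℕ) : ℤ) + 2)) * hs + j * hc' + (-y) * hn'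

/-- `e(−4m/16) = (−i)^m` for `m : ℕ`. [folklore] -/
theorem cexp_neg_four_mul_div_sixteen (m : ℕ) : cexp (2 * π * I * ((-(4 * (m : ℤ)) : ℤ) : ℂ) / 16) = (-I) ^ m := by
  have h1 : cexp (-(π / 2) * I) = -I := by
    rw [Complex.exp_mul_I, Complex.cos_neg, Complex.sin_neg, Complex.cos_pi_div_two, Complex.sin_pi_div_two]
    ring
  rw [← h1, ← Complex.exp_nat_mul]
  congr 1
  push_cast
  ring

/-! ## §3 The weight sum on the classes `≡ 2 (mod 4)` -/

/-- Each term of `W_c(n)`: with `μ_j = ε_j^{−K}`-type weights and `y_j + j ≡ 0 (mod 8)`,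
`(e(−cj/16)/16)·μ_j·e(y_j n/16) = μ_j·(−i)^{j t}/16`, `t = c/4 + n/4 + 1`. [folklore] -/
theorem flipWeightSixteen_term {c n : ℕ} (hc : c % 4 = 2) (hn : n % 4 = 2) (j : ℕ) {y : ℤ} (μ : ℂ)
    (hyj : y + (j : ℤ) ≡ 0 [ZMOD 8]) :
    cexp (-(2 * π * I * ((c * j : ℕ) : ℂ) / 16)) / 16 * μ * cexp (2 * π * I * ((y * n : ℤ) : ℂ) / 16) =
      μ * (-I) ^ (j * (c / 4 + n / 4 + 1)) / 16 := by
  have hcomb : cexp (-(2 * π * I * ((c * j : ℕ) : ℂ) / 16)) * cexp (2 * π * I * ((y * n : ℤ) : ℂ) / 16) =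
      cexp (2 * π * I * ((y * n - c * j : ℤ) : ℂ) / 16) := by
    rw [← Complex.exp_add]
    congr 1
    push_cast
    ring
  have hmod := phaseExponent_modEq hc hn (j := (j : ℤ)) hyj
  have hph : cexp (2 * π * I * ((y * n - c * j : ℤ) : ℂ) / 16) = (-I) ^ (j * (c / 4 + n / 4 + 1)) := by
    rw [cexp_div_sixteen_eq_of_modEq hmod, show (j : ℤ) * ((c / 4 + n / 4 + 1 : ℕ) : ℤ) = ((j * (c / 4 + n / 4 + 1) : ℕ) : ℤ) by push_cast; ring,
      cexp_neg_four_mul_div_sixteen]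
  calc cexp (-(2 * π * I * ((c * j : ℕ) : ℂ) / 16)) / 16 * μ * cexp (2 * π * I * ((y * n : ℤ) : ℂ) / 16)
      = μ * (cexp (-(2 * π * I * ((c * j : ℕ) : ℂ) / 16)) * cexp (2 * π * I * ((y * n : ℤ) : ℂ) / 16)) / 16 := by ring
    _ = μ * (-I) ^ (j * (c / 4 + n / 4 + 1)) / 16 := by rw [hcomb, hph]

/-- Powers of `−i`: `(−i)^4 = 1`, so `(−i)^{jt} = ((−i)^t)` for `j ≡ 1 (mod 4)` and `= ((−i)^t)³` for `j ≡ 3 (mod 4)`. [folklore] -/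
theorem negI_pow_mul_eq (j t : ℕ) : (-I) ^ (j * t) = ((-I) ^ t) ^ (j % 4) := by
  have h4 : (-I) ^ 4 = 1 := by rw [neg_pow, Complex.I_pow_four]; norm_num
  have hj : j * t = t * (j % 4) + 4 * (j / 4 * t) := by
    conv_lhs => rw [← Nat.mod_add_div j 4]
    ring
  rw [hj, pow_add, pow_mul, pow_mul, h4, one_pow, mul_one]

/-- **THE WEIGHT SUM ON THE CLASSES `≡ 2 (mod 4)`.** With weights `μ_j = 1` for `j ≡ 1 (mod 4)` and `μ_j = s` for `j ≡ 3 (mod 4)`, and solutions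
`y_j` with `y_j + j ≡ 0 (mod 8)`: `W_c(n) = Σ_{j odd <16} (e(−cj/16)/16)·μ_j·e(y_j n/16) = (v + s·v³)/4`, `v = (−i)^{c/4 + n/4 + 1}`.
[cite: Shimura1973HalfIntegral, §1] -/
theorem flipWeightSixteen_sum_eq {c n : ℕ} (hc : c % 4 = 2) (hn : n % 4 = 2) (y : ℕ → ℤ) (μ : ℕ → ℂ) (s : ℂ)
    (hμ1 : ∀ j ∈ ({1, 3, 5, 7, 9, 11, 13, 15} : Finset ℕ), j % 4 = 1 → μ j = 1)
    (hμ3 : ∀ j ∈ ({1, 3, 5, 7, 9, 11, 13, 15} : Finset ℕ), j % 4 = 3 → μ j = s)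
    (hy : ∀ j ∈ ({1, 3, 5, 7, 9, 11, 13, 15} : Finset ℕ), y j + (j : ℤ) ≡ 0 [ZMOD 8]) :
    ∑ j ∈ ({1, 3, 5, 7, 9, 11, 13, 15} : Finset ℕ),
        cexp (-(2 * π * I * ((c * j : ℕ) : ℂ) / 16)) / 16 * μ j * cexp (2 * π * I * ((y j * n : ℤ) : ℂ) / 16) =
      ((-I) ^ (c / 4 + n / 4 + 1) + s * ((-I) ^ (c / 4 + n / 4 + 1)) ^ 3) / 4 := by
  set t := c / 4 + n / 4 + 1 with ht
  have hterm : ∀ j ∈ ({1, 3, 5, 7, 9, 11, 13, 15} : Finset ℕ),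
      cexp (-(2 * π * I * ((c * j : ℕ) : ℂ) / 16)) / 16 * μ j * cexp (2 * π * I * ((y j * n : ℤ) : ℂ) / 16) =
        μ j * ((-I) ^ t) ^ (j % 4) / 16 := by
    intro j hj
    rw [flipWeightSixteen_term hc hn j (μ j) (hy j hj), ← ht, negI_pow_mul_eq]
  rw [Finset.sum_congr rfl hterm]
  have m1 := hμ1 1 (by simp) (by norm_num); have m5 := hμ1 5 (by simp) (by norm_num)
  have m9 := hμ1 9 (by simp) (by norm_num); have m13 := hμ1 13 (by simp) (by norm_num)
  have m3 := hμ3 3 (by simp) (by norm_num); have m7 := hμ3 7 (by simp) (by norm_num)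
  have m11 := hμ3 11 (by simp) (by norm_num); have m15 := hμ3 15 (by simp) (by norm_num)
  norm_num [Finset.sum_insert, Finset.sum_singleton, m1, m3, m5, m7, m9, m11, m13, m15]
  ring

/-- **THE WEIGHT IS A UNIT: `W_c(n) · 2(v³ − s v) = 1`** for `K` odd, `s = (−i)^K` (`s² = −1`, `v⁴ = 1`). [folklore] -/
theorem flipWeightSixteen_closedForm_mul_eq_one {K : ℕ} (hK : Odd K) (t : ℕ) :
    ((-I) ^ t + (-I) ^ K * ((-I) ^ t) ^ 3) / 4 * (2 * (((-I) ^ t) ^ 3 - (-I) ^ K * (-I) ^ t)) = 1 := by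
  have hv4 : ((-I) ^ t) ^ 4 = 1 := by
    rw [← pow_mul, mul_comm, pow_mul, show (-I) ^ 4 = 1 by rw [neg_pow, Complex.I_pow_four]; norm_num, one_pow]
  have hs2 : ((-I) ^ K) ^ 2 = -1 := by
    obtain ⟨r, rfl⟩ := hK
    rw [← pow_mul, show (2 * r + 1) * 2 = 4 * r + 2 by ring, pow_add, pow_mul,
      show (-I) ^ 4 = 1 by rw [neg_pow, Complex.I_pow_four]; norm_num, one_pow, one_mul, neg_pow, Complex.I_sq]
    norm_num
  have key : ∀ v s : ℂ, v ^ 4 = 1 → s ^ 2 = -1 → (v + s * v ^ 3) / 4 * (2 * (v ^ 3 - s * v)) = 1 := by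
    intro v s hv hs
    linear_combination ((1 : ℂ) / 2 + (1 / 2) * s * v ^ 2 - (1 / 2) * s ^ 2) * hv + (-(1 : ℂ) / 2) * hs
  exact key _ _ hv4 hs2

/-- `v = (−i)^t`, `s = (−i)^K` and `2(v³ − sv)` are algebraic integers. [folklore] -/
theorem isIntegral_flipWeightSixteen_inverse (K t : ℕ) : IsIntegral ℤ (2 * (((-I) ^ t) ^ 3 - (-I) ^ K * (-I) ^ t)) := by
  have hI : IsIntegral ℤ (-I) := by
    refine IsIntegral.of_pow (n := 4) (by norm_num) ?_
    rw [neg_pow, Complex.I_pow_four]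
    norm_num
    exact isIntegral_one
  have h2 : IsIntegral ℤ (2 : ℂ) := by exact_mod_cast isIntegral_algebraMap (R := ℤ) (A := ℂ) (x := 2)
  exact h2.mul (((hI.pow t).pow 3).sub ((hI.pow K).mul (hI.pow t)))

/-- **P6b, ABSTRACT FORM: `∃ u` integral with `u · W_c(n) = 1`** — for `K` odd, `c ≡ n ≡ 2 (mod 4)`, weights `μ_j ∈ {1, (−i)^K}` by `j mod 4`,
and solutions with `y_j + j ≡ 0 (mod 8)`. [cite: Shimura1973HalfIntegral, §1] -/
theorem exists_isIntegral_mul_flipWeightSixteen_eq_one {K c n : ℕ} (hK : Odd K) (hc : c % 4 = 2) (hn : n % 4 = 2) (y : ℕ → ℤ)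
    (μ : ℕ → ℂ) (hμ1 : ∀ j ∈ ({1, 3, 5, 7, 9, 11, 13, 15} : Finset ℕ), j % 4 = 1 → μ j = 1)
    (hμ3 : ∀ j ∈ ({1, 3, 5, 7, 9, 11, 13, 15} : Finset ℕ), j % 4 = 3 → μ j = (-I) ^ K)
    (hy : ∀ j ∈ ({1, 3, 5, 7, 9, 11, 13, 15} : Finset ℕ), y j + (j : ℤ) ≡ 0 [ZMOD 8]) :
    ∃ u : ℂ, IsIntegral ℤ u ∧
      u * ∑ j ∈ ({1, 3, 5, 7, 9, 11, 13, 15} : Finset ℕ),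
        cexp (-(2 * π * I * ((c * j : ℕ) : ℂ) / 16)) / 16 * μ j * cexp (2 * π * I * ((y j * n : ℤ) : ℂ) / 16) = 1 := by
  refine ⟨2 * (((-I) ^ (c / 4 + n / 4 + 1)) ^ 3 - (-I) ^ K * (-I) ^ (c / 4 + n / 4 + 1)),
    isIntegral_flipWeightSixteen_inverse K _, ?_⟩
  rw [flipWeightSixteen_sum_eq hc hn y μ ((-I) ^ K) hμ1 hμ3 hy, mul_comm]
  exact flipWeightSixteen_closedForm_mul_eq_one hK _

/-! ## §4 The square levels `M′ = Q²` with the trivial character: all multiplier hypotheses discharged -/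

/-- `ε_j^{−K}` for `j ≡ 1 (mod 4)` is `1`, for `j ≡ 3 (mod 4)` is `(−i)^K`. [folklore] -/
theorem thetaEps_inv_pow_eq (K : ℕ) (d : ℤ) :
    ((thetaEps d)⁻¹) ^ K = if d % 4 = 3 then (-I) ^ K else 1 := by
  unfold thetaEps
  split_ifs with h
  · rw [Complex.inv_I]
  · simp

/-- **P6b FOR THE LINE (square level `4Q²`, trivial character).** Let `Q` be odd, `M′ = Q²`, `K` odd, `c ≡ n ≡ 2 (mod 4)`, and for the odd `j < 16`
let `y_j ≤ 0` solve `M′²·j·y_j ≡ −1 (mod 16)` (P6c's `sq_mul_mul_modEq_neg_one_sixteen`), `d_j = 16 − M′y_j`. Then the weight of P6c's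
`hasSum_oddPartSixteen_flippedCusp_of_det` with `ω(j) = e(−cj/16)/16` and `ψ = 𝟙`,
`W_c(n) = Σ_j (e(−cj/16)/16)·𝟙(d_j)·(ε_{d_j}⁻¹·J(16M′ | d_j))^K·e(y_j n/16)`, satisfies `u·W_c(n) = 1` for an algebraic integer `u`: it is a
unit at every odd prime, for every class `n ≡ 2 (mod 4)` — the `e = 3` flipped-cusp rung has NO dead class. [cite: Shimura1973HalfIntegral, §1, Prop. 1.5] -/
theorem exists_isIntegral_mul_flipWeightSixteen_eq_one_of_sq {Q K c n : ℕ} (hQ : Odd Q) (hK : Odd K) (hc : c % 4 = 2)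
    (hn : n % 4 = 2) (y : ℕ → ℤ)
    (hy : ∀ j ∈ ({1, 3, 5, 7, 9, 11, 13, 15} : Finset ℕ), ((Q ^ 2 : ℕ) : ℤ) ^ 2 * (j : ℤ) * y j ≡ -1 [ZMOD 16]) :
    ∃ u : ℂ, IsIntegral ℤ u ∧
      u * ∑ j ∈ ({1, 3, 5, 7, 9, 11, 13, 15} : Finset ℕ),
        cexp (-(2 * π * I * ((c * j : ℕ) : ℂ) / 16)) / 16 *
          ((1 : DirichletCharacter ℂ (4 * Q ^ 2)) (((16 - ((Q ^ 2 : ℕ) : ℤ) * y j : ℤ)) : ZMod (4 * Q ^ 2)) *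
            ((thetaEps (16 - ((Q ^ 2 : ℕ) : ℤ) * y j))⁻¹ * (J(16 * ((Q ^ 2 : ℕ) : ℤ) | (16 - ((Q ^ 2 : ℕ) : ℤ) * y j).natAbs) : ℂ)) ^ K) *
          cexp (2 * π * I * ((y j * n : ℤ) : ℂ) / 16) = 1 := by
  have hQZ : Odd (Q : ℤ) := by exact_mod_cast hQ
  have hM : Odd (((Q ^ 2 : ℕ) : ℤ)) := by push_cast; exact hQZ.pow
  have hM4 : (((Q ^ 2 : ℕ) : ℤ)) % 4 = 1 := by
    obtain ⟨r, hr⟩ := hQZ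
    push_cast
    rw [hr]
    have : (2 * r + 1) ^ 2 = 4 * (r * r + r) + 1 := by ring
    omega
  have hodd : ∀ j ∈ ({1, 3, 5, 7, 9, 11, 13, 15} : Finset ℕ), Odd (j : ℤ) := by
    intro j hj
    simp only [Finset.mem_insert, Finset.mem_singleton] at hj
    rcases hj with rfl | rfl | rfl | rfl | rfl | rfl | rfl | rfl <;> decide
  refine exists_isIntegral_mul_flipWeightSixteen_eq_one hK hc hn y _ ?_ ?_ ?_
  · intro j hj hj1
    have hd4 := d_emod_four_eq_of_solution hM4 (hodd j hj) (hy j hj)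
    have hdodd := odd_d_of_solution hM (hy j hj)
    have hcop : IsCoprime (Q : ℤ) (16 - ((Q ^ 2 : ℕ) : ℤ) * y j) := by push_cast; exact isCoprime_Q_d hQZ
    rw [one_apply_d_eq_one hcop hdodd, one_mul, show (16 : ℤ) * ((Q ^ 2 : ℕ) : ℤ) = 16 * (Q : ℤ) ^ 2 by push_cast; ring,
      jacobiSym_sixteen_mul_sq_eq_one hcop hdodd, Int.cast_one, mul_one, thetaEps_inv_pow_eq, hd4]
    have : ¬ ((j : ℤ) % 4 = 3) := by omega
    rw [if_neg this]
  · intro j hj hj3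
    have hd4 := d_emod_four_eq_of_solution hM4 (hodd j hj) (hy j hj)
    have hdodd := odd_d_of_solution hM (hy j hj)
    have hcop : IsCoprime (Q : ℤ) (16 - ((Q ^ 2 : ℕ) : ℤ) * y j) := by push_cast; exact isCoprime_Q_d hQZ
    rw [one_apply_d_eq_one hcop hdodd, one_mul, show (16 : ℤ) * ((Q ^ 2 : ℕ) : ℤ) = 16 * (Q : ℤ) ^ 2 by push_cast; ring,
      jacobiSym_sixteen_mul_sq_eq_one hcop hdodd, Int.cast_one, mul_one, thetaEps_inv_pow_eq, hd4]
    have : ((j : ℤ) % 4 = 3) := by omega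
    rw [if_pos this]
  · intro j hj
    exact add_modEq_zero_eight_of_solution hM (hodd j hj) (hy j hj)

end Summit.BirchSwinnertonDyer.BirchSwinnertonDyer.Theorems.PrintCFram.FlipRung

end
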